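import Mathlib.Combinatorics.Matroid.IndepAxioms
import Mathlib.Combinatorics.Matroid.Closure
import Mathlib.Combinatorics.Matroid.Minor.Contract
import Mathlib.Combinatorics.Matroid.Rank.ENat
import Literature.Combinatorics.Matroid.RelRank
import Literature.ModelTheory.Quasiminimal.PregeometryStructures
import HarnessLib

/-!
# The matroid of a pregeometry (dimension theory for quasiminimal pregeometry structures)

`Literature/ModelTheory/Quasiminimal/PregeometryStructures.lean` records a pregeometry as a bare
closure operator `cl : Set M → Set M` with exchange and finite character
(`Literature.ModelTheory.Quasiminimal.IsPregeometry`). The categoricity / existence theory of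
quasiminimal classes (J. Kirby, *On quasiminimal excellent classes*, JSL 75 (2010);
Bays–Hart–Hyttinen–Kesälä–Kirby, *Quasiminimal structures and excellence*, BLMS 46 (2014))
constantly uses its *dimension theory*: independent sets, bases over a closed set, the fact that
isomorphic closed sets have complements of the same dimension, `cl X ∩ cl Y = cl (X ∩ Y)` inside a
basis, and so on. Rather than redeveloping this, we attach to `cl` the (finitary) `Matroid` on
`M` whose independent sets are the `cl`-independent sets, prove that its closure operator is `cl`,
and read dimensions off Mathlib's `Matroid.eRk` / contractions `M ／ C` and the relative rank
`Matroid.relRank` of `Literature/Combinatorics/Matroid/RelRank.lean`.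

## Contents (all proved, all folklore)

* `ClIndep cl I` — `I` is `cl`-independent: no `e ∈ I` lies in `cl (I \ {e})`.
* `IsPregeometry.mem_cl_of_not_clIndep_insert`, `IsPregeometry.clIndep_insert` — the exchange
  lemma in independence form.
* `IsPregeometry.matroid` — the matroid on `univ` with `Indep = ClIndep cl`
  (`IndepMatroid.ofFinitary`; augmentation from exchange, compactness from finite character);
  `matroid_indep_iff`, `matroid_E`, `matroid_finitary`.
* `IsPregeometry.matroid_closure` — its closure operator is `cl`; `isFlat_iff`.
* `IsPregeometry.contract_indep_iff` — independence over a set `C` (in `matroid ／ C`) is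
  "`e ∉ cl (C ∪ (I \ {e}))`"; `exists_indepFamily_over` — every set `G` admits a family
  independent over `G` with `cl (G ∪ range b) = univ` (a basis of the contraction).

## References

* J. Oxley, *Matroid Theory*, 2nd ed., OUP 2011, §1.4 (closure axioms ⟺ matroids, finite case).
* J. Kirby, *On quasiminimal excellent classes*, J. Symbolic Logic 75 (2010) 551–564, §1
  (pregeometries with the countable closure property).
-/

noncomputable section

open Set
open scoped Matroid

namespace Literature.ModelTheory.Quasiminimal

variable {M : Type*} {cl : Set M → Set M}

/-! ### `cl`-independent sets -/

/-- A set `I` is **independent** for the closure operator `cl` if no element of `I` lies in the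
closure of the others: `e ∉ cl (I \ {e})` for all `e ∈ I` (Kirby 2010 §1, "independent").
[folklore] -/
def ClIndep (cl : Set M → Set M) (I : Set M) : Prop :=
  ∀ ⦃e : M⦄, e ∈ I → e ∉ cl (I \ {e})

/-- The empty set is independent. [folklore] -/
theorem clIndep_empty : ClIndep cl (∅ : Set M) := fun _ he => he.elim

/-- Subsets of independent sets are independent (for a monotone closure operator). [folklore] -/
theorem ClIndep.subset (hmono : ∀ ⦃A B : Set M⦄, A ⊆ B → cl A ⊆ cl B) {I J : Set M}
    (hJ : ClIndep cl J) (hIJ : I ⊆ J) : ClIndep cl I :=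
  fun _ he hecl => hJ (hIJ he) (hmono (sdiff_subset_sdiff_left hIJ) hecl)

namespace IsPregeometry

/-- **Exchange, independence form.** If `I` is independent and `insert e I` is not, then
`e ∈ cl I`. [folklore] -/
theorem mem_cl_of_not_clIndep_insert (h : IsPregeometry cl) {I : Set M} {e : M}
    (hI : ClIndep cl I) (he : ¬ ClIndep cl (insert e I)) : e ∈ cl I := by
  by_contra hecl
  apply he
  intro x hx hxcl
  rcases eq_or_ne x e with rfl | hxe
  · refine hecl (h.mono ?_ hxcl)
    intro y hy
    simp only [mem_sdiff, mem_insert_iff, mem_singleton_iff] at hy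
    tauto
  · have hxI : x ∈ I := by
      rcases (mem_insert_iff.1 hx) with hx | hx
      · exact absurd hx hxe
      · exact hx
    have h1 : insert e I \ {x} = insert e (I \ {x}) := by
      ext y
      simp only [mem_sdiff, mem_insert_iff, mem_singleton_iff]
      constructor
      · rintro ⟨hy | hy, hyx⟩
        · exact Or.inl hy
        · exact Or.inr ⟨hy, hyx⟩
      · rintro (hy | ⟨hy, hyx⟩)
        · exact ⟨Or.inl hy, fun hyx => hxe (hyx ▸ hy.symm ▸ rfl)⟩
        · exact ⟨Or.inr hy, hyx⟩
    rw [h1] at hxcl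
    have hx2 : x ∉ cl (I \ {x}) := hI hxI
    have h3 := h.exchange hxcl hx2
    rw [insert_sdiff_singleton, insert_eq_of_mem hxI] at h3
    exact hecl h3

/-- Adding an element outside `cl I` keeps `I` independent. [folklore] -/
theorem clIndep_insert (h : IsPregeometry cl) {I : Set M} {e : M} (hI : ClIndep cl I)
    (he : e ∉ cl I) : ClIndep cl (insert e I) := by
  by_contra hc
  exact he (h.mem_cl_of_not_clIndep_insert hI hc)

/-- Adding an element of `cl I ∖ I` destroys independence. [folklore] -/
theorem not_clIndep_insert_of_mem_cl {I : Set M} {e : M} (he : e ∈ cl I)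
    (heI : e ∉ I) : ¬ ClIndep cl (insert e I) := by
  intro hc
  have := hc (mem_insert e I)
  rw [insert_sdiff_of_mem _ (mem_singleton e), sdiff_singleton_eq_self heI] at this
  exact this he

/-- A maximal independent set spans. [folklore] -/
theorem cl_eq_univ_of_maximal (h : IsPregeometry cl) {B : Set M} (hB : Maximal (ClIndep cl) B) :
    cl B = univ := by
  refine eq_univ_of_forall fun x => ?_
  by_contra hx
  have hxB : x ∉ B := fun hxB => hx (h.subset_cl B hxB)
  exact hxB (hB.mem_of_prop_insert (h.clIndep_insert hB.prop hx))

/-- A spanning independent set is a maximal independent set. [folklore] -/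
theorem maximal_of_cl_eq_univ (h : IsPregeometry cl) {I : Set M} (hI : ClIndep cl I)
    (hcl : cl I = univ) : Maximal (ClIndep cl) I := by
  rw [maximal_iff_forall_insert (fun _ _ hJ hIJ => hJ.subset h.mono hIJ)]
  exact ⟨hI, fun x hx => not_clIndep_insert_of_mem_cl (hcl ▸ mem_univ x) hx⟩

/-! ### The matroid -/

/-- **The matroid of a pregeometry**: ground set `univ`, independent sets the `cl`-independent
sets. Augmentation is the exchange property, and independence is of finite character because
`cl` is (so `IndepMatroid.ofFinitary` applies and the matroid is `Finitary`).
(Oxley, *Matroid Theory*, §1.4, for finite ground sets; folklore in general.) [folklore] -/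
protected def matroid (h : IsPregeometry cl) : Matroid M :=
  (IndepMatroid.ofFinitary (univ : Set M) (ClIndep cl) clIndep_empty
    (fun _ _ hJ hIJ => hJ.subset h.mono hIJ)
    (by
      intro I B hI hInotmax hBmax
      by_contra hcon
      push Not at hcon
      apply hInotmax
      apply h.maximal_of_cl_eq_univ hI
      have hBcl : B ⊆ cl I := fun x hxB => by
        by_cases hxI : x ∈ I
        · exact h.subset_cl I hxI
        · exact h.mem_cl_of_not_clIndep_insert hI (hcon x ⟨hxB, hxI⟩)
      apply eq_univ_of_univ_subset
      rw [← h.cl_eq_univ_of_maximal hBmax]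
      calc cl B ⊆ cl (cl I) := h.mono hBcl
        _ = cl I := h.cl_cl I)
    (by
      intro I hfin e heI hecl
      obtain ⟨J₀, hJ₀, hJ₀fin, heJ₀⟩ := h.finite_character hecl
      have heJ : e ∉ J₀ := fun he => (hJ₀ he).2 rfl
      have hJI : insert e J₀ ⊆ I := insert_subset heI (hJ₀.trans sdiff_subset)
      have hind := hfin (insert e J₀) hJI (hJ₀fin.insert e)
      refine hind (mem_insert e J₀) (h.mono ?_ heJ₀)
      intro y hy
      exact ⟨mem_insert_of_mem e hy, fun hye => heJ (mem_singleton_iff.1 hye ▸ hy)⟩)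
    (fun I _ => subset_univ I)).matroid

/-- The ground set of the matroid of a pregeometry is everything. [folklore] -/
@[simp] theorem matroid_E (h : IsPregeometry cl) : h.matroid.E = univ := rfl

/-- Independence in the matroid of a pregeometry is `cl`-independence. [folklore] -/
@[simp] theorem matroid_indep_iff (h : IsPregeometry cl) {I : Set M} :
    h.matroid.Indep I ↔ ClIndep cl I := Iff.rfl

/-- The matroid of a pregeometry is finitary. [folklore] -/
instance matroid_finitary (h : IsPregeometry cl) : h.matroid.Finitary := by
  unfold IsPregeometry.matroid
  infer_instance

/-- **The closure operator of the matroid of a pregeometry is `cl`.** [folklore] -/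
theorem matroid_closure (h : IsPregeometry cl) (X : Set M) : h.matroid.closure X = cl X := by
  obtain ⟨I, hI⟩ := h.matroid.exists_isBasis X (by simp)
  have hIind : ClIndep cl I := hI.indep
  have hclI : h.matroid.closure I = cl I := by
    ext e
    rw [hI.indep.mem_closure_iff']
    simp only [matroid_E, mem_univ, true_and, matroid_indep_iff]
    constructor
    · intro hins
      by_cases heI : e ∈ I
      · exact h.subset_cl I heI
      · exact h.mem_cl_of_not_clIndep_insert hIind fun hc => heI (hins hc)
    · intro he hins
      by_contra heI
      exact not_clIndep_insert_of_mem_cl he heI hins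
  rw [← hI.closure_eq_closure, hclI]
  refine Subset.antisymm (h.mono hI.subset) ?_
  have hX : X ⊆ cl I := hclI ▸ hI.subset_closure
  calc cl X ⊆ cl (cl I) := h.mono hX
    _ = cl I := h.cl_cl I

/-- Flats of the matroid of a pregeometry are the `cl`-closed sets. [folklore] -/
theorem isFlat_iff (h : IsPregeometry cl) {F : Set M} : h.matroid.IsFlat F ↔ cl F = F := by
  rw [Matroid.isFlat_iff_closure_eq, matroid_closure]

/-- A `cl`-independent set is independent in the matroid (dot-notation helper). [folklore] -/
theorem indep_of_clIndep (h : IsPregeometry cl) {I : Set M} (hI : ClIndep cl I) :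
    h.matroid.Indep I :=
  (matroid_indep_iff h).2 hI

/-! ### Independence over a set: the contraction `matroid ／ C` -/

/-- **Independence over `C`.** A set `I` is independent in the contraction `matroid ／ C` iff it is
disjoint from `C` and no `e ∈ I` lies in `cl (C ∪ (I \ {e}))`. [folklore] -/
theorem contract_indep_iff (h : IsPregeometry cl) {C I : Set M} :
    (h.matroid ／ C).Indep I ↔ Disjoint I C ∧ ∀ ⦃e : M⦄, e ∈ I → e ∉ cl (C ∪ (I \ {e})) := by
  rw [Matroid.indep_iff_forall_notMem_closure_sdiff']
  simp only [Matroid.contract_ground, matroid_E, Matroid.contract_closure_eq, matroid_closure,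
    mem_sdiff, not_and, not_not]
  constructor
  · rintro ⟨hsub, hcl⟩
    have hdisj : Disjoint I C := disjoint_left.2 fun e heI heC => (hsub heI).2 heC
    refine ⟨hdisj, fun e heI hecl => ?_⟩
    rw [union_comm] at hecl
    exact disjoint_left.1 hdisj heI (hcl e heI hecl)
  · rintro ⟨hdisj, hcl⟩
    refine ⟨fun e heI => ⟨mem_univ e, disjoint_left.1 hdisj heI⟩, fun e heI hecl => ?_⟩
    rw [union_comm] at hecl
    exact absurd hecl (hcl heI)

end IsPregeometry

/-- A family `b : ι → M` is **independent over `G`** if no `b i` lies in the closure of `G` and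
the other members. (Kirby 2010 §2: "`B` a basis of `H` over `G`", independence part.)
[folklore] -/
def IndepFamilyOver (cl : Set M → Set M) (G : Set M) {ι : Type*} (b : ι → M) : Prop :=
  ∀ i, b i ∉ cl (G ∪ b '' {j | j ≠ i})

/-- Members of a family independent over `G` are not in `cl G`. [folklore] -/
theorem IndepFamilyOver.notMem_cl (h : IsPregeometry cl) {G : Set M} {ι : Type*} {b : ι → M}
    (hb : IndepFamilyOver cl G b) (i : ι) : b i ∉ cl G :=
  fun hi => hb i (h.mono subset_union_left hi)

/-- A family independent over `G` is injective. [folklore] -/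
theorem IndepFamilyOver.injective (h : IsPregeometry cl) {G : Set M}
    {ι : Type*} {b : ι → M} (hb : IndepFamilyOver cl G b) : Function.Injective b := by
  intro i j hij
  by_contra hne
  refine hb i (h.subset_cl _ (Or.inr ⟨j, ?_, hij.symm⟩))
  exact fun hji => hne hji.symm

/-- A family independent over `G` is disjoint from `G`. [folklore] -/
theorem IndepFamilyOver.notMem (h : IsPregeometry cl) {G : Set M}
    {ι : Type*} {b : ι → M} (hb : IndepFamilyOver cl G b) (i : ι) : b i ∉ G :=
  fun hi => hb.notMem_cl h i (h.subset_cl G hi)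

/-- The range of a family independent over `G` is independent in `matroid ／ G`. [folklore] -/
theorem IndepFamilyOver.contract_indep (h : IsPregeometry cl) {G : Set M} {ι : Type*}
    {b : ι → M} (hb : IndepFamilyOver cl G b) : (h.matroid ／ G).Indep (range b) := by
  rw [h.contract_indep_iff]
  refine ⟨disjoint_left.2 ?_, ?_⟩
  · rintro _ ⟨i, rfl⟩ hi
    exact hb.notMem h i hi
  · rintro _ ⟨i, rfl⟩ hcl
    refine hb i (h.mono (union_subset_union_right _ ?_) hcl)
    rintro _ ⟨⟨j, rfl⟩, hj⟩
    exact ⟨j, fun hji => hj (by rw [mem_singleton_iff, hji]), rfl⟩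

namespace IsPregeometry

/-- Conversely, an injective enumeration of a set independent in `matroid ／ G` is a family
independent over `G`. [folklore] -/
theorem indepFamilyOver_of_contract_indep (h : IsPregeometry cl) {G : Set M} {ι : Type*}
    {b : ι → M} (hinj : Function.Injective b) (hb : (h.matroid ／ G).Indep (range b)) :
    IndepFamilyOver cl G b := by
  rw [h.contract_indep_iff] at hb
  intro i hi
  refine hb.2 (mem_range_self i) (h.mono (union_subset_union_right _ ?_) hi)
  rintro _ ⟨j, hj, rfl⟩
  exact ⟨mem_range_self j, fun hji => hj (hinj (mem_singleton_iff.1 hji))⟩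

/-- **Bases over a set.** For every `G ⊆ M` there is a family `b` independent over `G` which,
together with `G`, spans `M`: an injective enumeration of a base of the contraction `matroid ／ G`
(Kirby 2010 §2, "a basis of `H` over `G`"). The index type is a subtype of `M`. [folklore] -/
theorem exists_indepFamilyOver (h : IsPregeometry cl) (G : Set M) :
    ∃ B : Set M, IndepFamilyOver cl G ((↑) : B → M) ∧ cl (G ∪ B) = univ ∧
      (h.matroid ／ G).IsBase B := by
  obtain ⟨B, hB⟩ := (h.matroid ／ G).exists_isBase
  refine ⟨B, ?_, ?_, hB⟩
  · refine h.indepFamilyOver_of_contract_indep Subtype.coe_injective ?_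
    rw [Subtype.range_coe]
    exact hB.indep
  · have hcl := hB.closure_eq
    rw [Matroid.contract_closure_eq, Matroid.contract_ground, matroid_closure, matroid_E] at hcl
    apply eq_univ_of_forall
    intro x
    by_cases hx : x ∈ G
    · exact h.subset_cl _ (Or.inl hx)
    · have : x ∈ univ \ G := ⟨mem_univ x, hx⟩
      rw [← hcl] at this
      rw [union_comm]
      exact this.1

/-- Extending an independent family: for `G ⊆ M` and a set `I` independent in `matroid ／ G` there
is a base `B ⊇ I` of `matroid ／ G`; it is independent over `G` and spans together with `G`.
[folklore] -/
theorem exists_indepFamilyOver_superset (h : IsPregeometry cl) (G : Set M) {I : Set M}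
    (hI : (h.matroid ／ G).Indep I) :
    ∃ B : Set M, I ⊆ B ∧ IndepFamilyOver cl G ((↑) : B → M) ∧ cl (G ∪ B) = univ ∧
      (h.matroid ／ G).IsBase B := by
  obtain ⟨B, hB, hIB⟩ := hI.exists_isBase_superset
  refine ⟨B, hIB, ?_, ?_, hB⟩
  · refine h.indepFamilyOver_of_contract_indep Subtype.coe_injective ?_
    rw [Subtype.range_coe]
    exact hB.indep
  · have hcl := hB.closure_eq
    rw [Matroid.contract_closure_eq, Matroid.contract_ground, matroid_closure, matroid_E] at hcl
    apply eq_univ_of_forall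
    intro x
    by_cases hx : x ∈ G
    · exact h.subset_cl _ (Or.inl hx)
    · have : x ∈ univ \ G := ⟨mem_univ x, hx⟩
      rw [← hcl] at this
      rw [union_comm]
      exact this.1

/-- The relative rank over `G` of the range of a family independent over `G` is its cardinality.
[folklore] -/
theorem _root_.Literature.ModelTheory.Quasiminimal.IndepFamilyOver.relRank_eq (h : IsPregeometry cl) {G : Set M} {ι : Type*} {b : ι → M}
    (hb : IndepFamilyOver cl G b) : h.matroid.relRank G (range b) = (range b).encard := by
  rw [Matroid.relRank_eq_eRk_contract]
  exact (hb.contract_indep h).eRk_eq_encard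

/-- In a base `B` of `matroid ／ G`, the cardinality of `B` is the relative rank of `M` over `G`.
[folklore] -/
theorem encard_eq_relRank_univ (h : IsPregeometry cl) {G B : Set M}
    (hB : (h.matroid ／ G).IsBase B) : B.encard = h.matroid.relRank G univ := by
  rw [Matroid.relRank_eq_eRk_contract, Matroid.eRk_univ_eq, hB.encard_eq_eRank]

/-- **Closed sets spanned over `G` by an independent family have relative rank the size of the
family**: `relRank G (cl (G ∪ range b)) = #b`. [folklore] -/
theorem _root_.Literature.ModelTheory.Quasiminimal.IndepFamilyOver.relRank_cl_eq (h : IsPregeometry cl) {G : Set M} {ι : Type*}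
    {b : ι → M} (hb : IndepFamilyOver cl G b) :
    h.matroid.relRank G (cl (G ∪ range b)) = (range b).encard := by
  rw [← hb.relRank_eq h]
  refine h.matroid.relRank_congr_closure G ?_
  rw [matroid_closure, matroid_closure, union_eq_self_of_subset_right, union_comm]
  · exact h.cl_cl _
  · exact (subset_union_left).trans (h.subset_cl _)

end IsPregeometry

end Literature.ModelTheory.Quasiminimal

end
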